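/-
Copyright (c) 2026 the pub-hodgecm-mathlib formalisation cell (harness21).  Prover seat hodgecm-mathlib-LH7-p02 (g6): LH4-plan (g7) LAYER C brick (C3d) (WORDs 16:03:57Z ∕ #37),
census `F0/P3c/LH7/LH7-p02/g6/c3d/CENSUS-C3d-JZeroNearTrace.v1.LH7p02g6.md` 514859d906ce5cf1 — the TRACE-FRAME twin of ★ `UnitaryThreeBorelCosetCountJZeroNear` (F0P3b-p01 (g6));
FINDINGS #13 ∕ #19 of the LH4 (g7) record; 2026-09-02.
-/
import Literature.NumberTheory.Automorphic.UnitaryThreeBorelCosetCountJZeroNear                 -- ★ the TAME count: `maximalIdeal_integer_eq_span` (CITED), frame (`flickerPH`, `flickerHK`, `ρ_m`, `natCard_subtype_comp_eq_mul`)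
import Literature.NumberTheory.Automorphic.UnitaryThreePHTowerRhoUnramified                     -- ★ C2-A p851992 (LH4-p01): the four `ρ_m` heads `…_of_unram` + ★ p851950 `exists_coe_eq_borel_of_mem_flickerPH'`
import Literature.NumberTheory.LocalFields.UnramifiedQuadraticNormResidueShiftPairsTraceUnit     -- ★ p851995 (this hand): the frame-currency pair count `natCard_pairs_norm_congr_shift_frame_of_isUnit`
import HarnessLib

/-!
# Flicker's Prop. 13, cases (c)∕(e), AS A COSET COUNT — TRACE FRAME, every residue characteristic:
# `#{y ∈ P_H ⧸ (P_H ∩ H^K_m) : y⁻¹ τ₀ y ∈ H^K_m} = F · q^{m−1}(q+1) · (q+1)q^{2m−j−1}` over the frame-currency criterion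

Topic `NumberTheory/Automorphic` (road «D-N7-inert», LAYER C (trace frame), brick (C3d)); namespace `Literature.NumberTheory.Automorphic.UnitaryGroup`.  THEOREMS ONLY: no definition,
no named fact, no instance, no notation, no `sorry`; kernel lane `--supports stmt-HodgeConjecture-24833`.  Cell `pub/hodgecm-mathlib` (D-0151), crux H413; dealer LH4-plan (g7).
Twin of ★ `UnitaryThreeBorelCosetCountJZeroNear` (`hd : LocalConjDatum`, `2 ∈ 𝒪ˣ`) for the UNRAMIFIED datum `UnramifiedLocalConjDatum σ ϖ` with `(2 : K) ≠ 0` as a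
characteristic token only (C2-A's).  HC_CM is proved only modulo the 7 printed citations (2 remaining named inputs: hLiu418 = stmt-HodgeConjecture-24832, h413 =
stmt-HodgeConjecture-24833) until rung 0 closes; count-neutral ((D-UNR) stays PRINT by D74′); this file pays no letter.

THE CHANGE (census §0.2, dealer «=» WORD #37).  ★ reads the `j = 0` near criterion in print's ANTI-FIXED currency, `|N((uσu)⁻¹ + e + x) − (e² − 1)| ≤ |ϖ^j|` with `x̄` anti-fixed, and counts
with ★ FILE 8 — which needs `2 ∈ 𝒪ˣ` (FINDING #13).  In the trace frame the (C3b) normal form (★ p851968 §1 + LH4-plan's (k4) substitution) reads the same membership as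
**`|N((uσu)⁻¹ + e + (x·d₁⁻¹ + c₂)·g) − ϖ^{2ℓ}γ| ≤ |ϖ^j|`** — `x` still the (intrinsically anti-fixed) skew parameter of `p = p(u, x, w) ∈ P_H`, `d₁` an anti-fixed UNIT (so
`ȳ = x̄·d̄₁⁻¹ + c̄₂` runs over the FIXED classes — a 2-free bijection), `g` a FRAME element (`|σg − g| = 1`), `e` a `σ`-fixed UNIT, `c₂` `σ`-fixed integral, target `ϖ^{2ℓ}γ` with `1 ≤ ℓ`.
This file takes THAT criterion as the values-abstract binder `hce` (the (C3e)∕(C5)′ caller discharges it from ★ p851968 by `field_simp`; `κ, r, s, b₀` never appear here) and runs ★'s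
route: Step A (★ C2-A `ρ_m` heads `…_of_unram` + the frame dictionary §1) → Step B (★ `natCard_subtype_comp_eq_mul`) → Step C (★ C2-A surjectivity) → Step D = the anti-fixed ↔
fixed reindexing `x̄ ↦ x̄·d̄₁⁻¹ + c̄₂` + ★ p851995 `natCard_pairs_norm_congr_shift_frame_of_isUnit`.  CONCLUSION = ★'s RHS VERBATIM:
`F · (q^{m−1}(q+1)) · (q^{(m−ℓ)−(j−2ℓ)} · q^{m−ℓ−1}(q+1))`.  The equidistant sub-row (C3e-0) (`ℓ = 0`, FINDING #19: value × `(q+1−r)∕(q+1)`) is NOT here (`hℓ : 1 ≤ ℓ`).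

* §1 **`v_norm_sub_le_iff_factor_eq_frame`** — the dictionary `|N((aσa)⁻¹ + e + y·g) − c| ≤ |ϖ^j| ↔ factor_j(Z̄ σ̄Z̄) = c̄` (PORT of ★ `v_norm_sub_le_iff_factor_eq`, `+ x ↦ + y·g`,
  binder `hd ↦ UnramifiedLocalConjDatum`; ★ `maximalIdeal_integer_eq_span` CITED).
* §2 **`natCard_cosets_of_iff_norm_sub_le_frame`** — the coset count (PORT of ★ `natCard_cosets_of_iff_norm_sub_le`).

## References
* [Flicker1998UnitaryFL] Y. Z. Flicker, *Elementary proof of the fundamental lemma for a unitary group*, Canad. J. Math. 50 (1998), 74–98: Prop. 13 pp. 91–93, Prop. 8 p. 84.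
* [Rogawski1990] J. D. Rogawski, *Automorphic Representations of Unitary Groups in Three Variables* (1990), §4.9 p. 55.
-/

set_option autoImplicit false

open scoped MatrixGroups WithZero Valued
open Matrix

namespace Literature.NumberTheory.Automorphic

namespace UnitaryGroup

open Literature.NumberTheory.Automorphic.HermitianLattice (unitaryInt mem_unitaryInt_iff UnramifiedLocalConjDatum)
open Literature.NumberTheory.LocalFields.UnramifiedQuadraticNorm IsLocalRing

variable {K : Type*} [Field K] [Valued K ℤᵐ⁰] {ϖ : K} (σ : K →+* K) {J : Matrix (Fin 3) (Fin 3) K}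

/-! ## §1 The dictionary for the shifted norm condition in the frame currency -/

/-- **`|N(z) − c| ≤ |ϖ^j| ↔ factor_j(Z̄ σ̄Z̄) = c̄ (mod 𝓂^j)`** for `z = (aσa)⁻¹ + e + y·g` (`|a| = 1`, `e, y, g` integral, `c ∈ 𝒪`), where on classes modulo `𝓂^m`
`Z̄ = Ring.inverse (ā σ̄ā) + ē + ȳ·ḡ` — ★ `v_norm_sub_le_iff_factor_eq` with `+ x ↦ + y·g`, unramified datum (only `hd.vσ`, `hd.vϖ` are read). [cite: Flicker1998UnitaryFL, Prop. 13 p. 93] -/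
theorem v_norm_sub_le_iff_factor_eq_frame (hd : UnramifiedLocalConjDatum σ ϖ) (hσO : ∀ y : 𝒪[K], (σ.comp 𝒪[K].subtype) y ∈ 𝒪[K])
    {j m : ℕ} (hjm : j ≤ m) {a e y g c : K} (ha : Valued.v a = 1) (he : Valued.v e ≤ 1) (hy : Valued.v y ≤ 1) (hg : Valued.v g ≤ 1) (hc : Valued.v c ≤ 1) :
    Valued.v (((a * σ a)⁻¹ + e + y * g) * σ ((a * σ a)⁻¹ + e + y * g) - c) ≤ Valued.v (ϖ ^ j) ↔
      Ideal.Quotient.factor (Ideal.pow_le_pow_right hjm)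
        ((Ring.inverse (Ideal.Quotient.mk (𝓂[K] ^ m) ⟨a, ha.le⟩ *
              Ideal.quotientMap (𝓂[K] ^ m) ((σ.comp 𝒪[K].subtype).codRestrict 𝒪[K] hσO)
                (maximalIdeal_pow_le_comap_codRestrict σ hd.vϖ hd.vσ hσO m) (Ideal.Quotient.mk (𝓂[K] ^ m) ⟨a, ha.le⟩)) +
            Ideal.Quotient.mk (𝓂[K] ^ m) ⟨e, he⟩ + Ideal.Quotient.mk (𝓂[K] ^ m) ⟨y, hy⟩ * Ideal.Quotient.mk (𝓂[K] ^ m) ⟨g, hg⟩) *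
          Ideal.quotientMap (𝓂[K] ^ m) ((σ.comp 𝒪[K].subtype).codRestrict 𝒪[K] hσO)
            (maximalIdeal_pow_le_comap_codRestrict σ hd.vϖ hd.vσ hσO m)
            (Ring.inverse (Ideal.Quotient.mk (𝓂[K] ^ m) ⟨a, ha.le⟩ *
                Ideal.quotientMap (𝓂[K] ^ m) ((σ.comp 𝒪[K].subtype).codRestrict 𝒪[K] hσO)
                  (maximalIdeal_pow_le_comap_codRestrict σ hd.vϖ hd.vσ hσO m) (Ideal.Quotient.mk (𝓂[K] ^ m) ⟨a, ha.le⟩)) +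
              Ideal.Quotient.mk (𝓂[K] ^ m) ⟨e, he⟩ + Ideal.Quotient.mk (𝓂[K] ^ m) ⟨y, hy⟩ * Ideal.Quotient.mk (𝓂[K] ^ m) ⟨g, hg⟩)) =
        Ideal.Quotient.mk (𝓂[K] ^ j) ⟨c, hc⟩ := by
  have hσa : Valued.v (σ a) ≤ 1 := by rw [hd.vσ]; exact ha.le
  have hn1 : Valued.v (a * σ a) = 1 := by rw [map_mul, hd.vσ, ha, mul_one]
  have hn0 : a * σ a ≠ 0 := fun h => by rw [h, map_zero] at hn1; exact zero_ne_one hn1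
  have hninv : Valued.v (a * σ a)⁻¹ ≤ 1 := by rw [map_inv₀, hn1, inv_one]
  set σm := Ideal.quotientMap (𝓂[K] ^ m) ((σ.comp 𝒪[K].subtype).codRestrict 𝒪[K] hσO)
    (maximalIdeal_pow_le_comap_codRestrict σ hd.vϖ hd.vσ hσO m) with hσm
  have hσmk : ∀ (t : K) (ht : Valued.v t ≤ 1), σm (Ideal.Quotient.mk (𝓂[K] ^ m) ⟨t, ht⟩) =
      Ideal.Quotient.mk (𝓂[K] ^ m) ⟨σ t, by show Valued.v (σ t) ≤ 1; rw [hd.vσ]; exact ht⟩ := fun t ht => by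
    rw [hσm, Ideal.quotientMap_mk]; rfl
  -- the inverse class
  set nO : 𝒪[K] := ⟨a, ha.le⟩ * ⟨σ a, hσa⟩ with hnO
  set niO : 𝒪[K] := ⟨(a * σ a)⁻¹, hninv⟩ with hniO
  have hmul : Ideal.Quotient.mk (𝓂[K] ^ m) nO * Ideal.Quotient.mk (𝓂[K] ^ m) niO = 1 := by
    rw [← map_mul, ← map_one (Ideal.Quotient.mk (𝓂[K] ^ m))]
    congr 1
    apply Subtype.ext
    show (a * σ a) * (a * σ a)⁻¹ = 1
    exact mul_inv_cancel₀ hn0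
  have hunit : IsUnit (Ideal.Quotient.mk (𝓂[K] ^ m) nO) := isUnit_iff_exists_inv.2 ⟨_, hmul⟩
  have hinv : Ring.inverse (Ideal.Quotient.mk (𝓂[K] ^ m) ⟨a, ha.le⟩ * σm (Ideal.Quotient.mk (𝓂[K] ^ m) ⟨a, ha.le⟩)) =
      Ideal.Quotient.mk (𝓂[K] ^ m) niO := by
    rw [hσmk, ← map_mul, ← hnO, ← hunit.unit_spec, Ring.inverse_unit]
    exact Units.inv_eq_of_mul_eq_one_right (by rw [hunit.unit_spec]; exact hmul)
  -- the integral `z`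
  set zO : 𝒪[K] := niO + ⟨e, he⟩ + ⟨y, hy⟩ * ⟨g, hg⟩ with hzO
  have hzcoe : (zO : K) = (a * σ a)⁻¹ + e + y * g := rfl
  have hZ : Ring.inverse (Ideal.Quotient.mk (𝓂[K] ^ m) ⟨a, ha.le⟩ * σm (Ideal.Quotient.mk (𝓂[K] ^ m) ⟨a, ha.le⟩)) +
      Ideal.Quotient.mk (𝓂[K] ^ m) ⟨e, he⟩ + Ideal.Quotient.mk (𝓂[K] ^ m) ⟨y, hy⟩ * Ideal.Quotient.mk (𝓂[K] ^ m) ⟨g, hg⟩ =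
        Ideal.Quotient.mk (𝓂[K] ^ m) zO := by
    rw [hinv, hzO, map_add, map_add, map_mul]
  have hcoe : ((zO * ((σ.comp 𝒪[K].subtype).codRestrict 𝒪[K] hσO) zO - ⟨c, hc⟩ : 𝒪[K]) : K) =
      ((a * σ a)⁻¹ + e + y * g) * σ ((a * σ a)⁻¹ + e + y * g) - c := by
    rw [← hzcoe]; rfl
  rw [hZ, hσm, Ideal.quotientMap_mk, ← map_mul, Ideal.Quotient.factor_mk, Ideal.Quotient.eq, mem_maximalIdeal_pow_iff_v_le hd.vϖ, hcoe]

/-! ## §2 The coset count of cases (c)∕(e) over the frame-currency criterion -/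

section Count

variable [IsDiscreteValuationRing 𝒪[K]] [Finite (ResidueField 𝒪[K])] [IsAdicComplete (maximalIdeal 𝒪[K]) 𝒪[K]]

set_option maxHeartbeats 400000 in
/-- **PROP. 13, CASES (c)∕(e), AS A COSET COUNT over the FRAME-CURRENCY criterion — TRACE FRAME, every residue characteristic.**  Let `τ ∈ U` and suppose that for every
`p = p(u,x,w) ∈ P_H` **`p⁻¹ τ p ∈ H^K_m ↔ |N((uσu)⁻¹ + e + (x·d₁⁻¹ + c₂)·g) − ϖ^{2ℓ}γ| ≤ |ϖ^j|`** (binder `hce` — the (C3b) normal form after the (k4) substitution; `e` a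
`σ`-fixed UNIT, `c₂` `σ`-fixed integral, `g` a frame element `|σg − g| = 1`, `d₁` an anti-fixed unit, `γ` a `σ`-fixed unit, `1 ≤ ℓ`, `2ℓ < j ≤ m`).  Then, `F` denoting the
common size of the fibres of `ρ_m` on the coset space (`hfib`), `#{y ∈ P_H ⧸ (P_H ∩ H^K_m) : y⁻¹ τ y ∈ H^K_m} = F · (q^{m−1}(q+1)) · (q^{(m−ℓ)−(j−2ℓ)} · q^{m−ℓ−1}(q+1))` —
★'s RHS VERBATIM.  Route = ★ `natCard_cosets_of_iff_norm_sub_le`'s: count through `ρ_m` (★ C2-A `…_of_unram`), range by ★ C2-A surjectivity, the anti-fixed ↔ fixed reindexing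
`x̄ ↦ x̄·d̄₁⁻¹ + c̄₂`, the pair count ★ `natCard_pairs_norm_congr_shift_frame_of_isUnit` at `R = 𝒪[K]`. [cite: Flicker1998UnitaryFL, Prop. 13 p. 93; Prop. 8 p. 84] -/
theorem natCard_cosets_of_iff_norm_sub_le_frame (hJ : J = (StdForm.antidiagonal 3).over K) (hd : UnramifiedLocalConjDatum σ ϖ) (h2 : (2 : K) ≠ 0)
    (hσO : ∀ y : 𝒪[K], (σ.comp 𝒪[K].subtype) y ∈ 𝒪[K]) {m j ℓ : ℕ} (hm : 1 ≤ m) (hℓ : 1 ≤ ℓ) (hj : 2 * ℓ < j) (hjm : j ≤ m)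
    {c um τ : ↥(unitaryGroupOfForm σ J)} (hc : ((c : GL (Fin 3) K) : Matrix (Fin 3) (Fin 3) K) = !![1, 0, 0; 0, -1, 0; 0, 0, 1])
    {e c₂ g d₁ γ : K} (he : Valued.v e = 1) (hσe : σ e = e) (hc₂ : Valued.v c₂ ≤ 1) (hσc₂ : σ c₂ = c₂) (hg : Valued.v g ≤ 1)
    (hσg : Valued.v (σ g - g) = 1) (hd₁ : Valued.v d₁ = 1) (hσd₁ : σ d₁ = -d₁) (hγ : Valued.v γ = 1) (hσγ : σ γ = γ)
    (hce : ∀ p ∈ flickerPH σ J c, ∀ u x w : K,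
      ((p : GL (Fin 3) K) : Matrix (Fin 3) (Fin 3) K) = !![u, 0, u * x; 0, w, 0; 0, 0, (σ u)⁻¹] →
        (p⁻¹ * τ * p ∈ flickerHK σ J c um ↔
          Valued.v (((u * σ u)⁻¹ + e + (x * d₁⁻¹ + c₂) * g) * σ ((u * σ u)⁻¹ + e + (x * d₁⁻¹ + c₂) * g) - ϖ ^ (2 * ℓ) * γ) ≤ Valued.v (ϖ ^ j)))
    {q : ℕ} (hq : Nat.card (ResidueField 𝒪[K]) = q ^ 2)
    {a₀ : 𝒪[K]} (ha₀ : IsUnit (((σ.comp 𝒪[K].subtype).codRestrict 𝒪[K] hσO) a₀ - a₀))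
    (hSN : flickerPH σ J c ⊓ flickerHK σ J c um ≤ flickerPH0 σ J c (ϖ ^ m))
    [Finite (↥(flickerPH σ J c) ⧸ (flickerHK σ J c um).subgroupOf (flickerPH σ J c))] {F : ℕ}
    (hfib : ∀ z ∈ Set.range (fun w : ↥(flickerPH σ J c) ⧸ (flickerHK σ J c um).subgroupOf (flickerPH σ J c) =>
        flickerPHRho σ m ((Quotient.out w : ↥(flickerPH σ J c)) : ↥(unitaryGroupOfForm σ J))),
      Nat.card {w : ↥(flickerPH σ J c) ⧸ (flickerHK σ J c um).subgroupOf (flickerPH σ J c) //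
        flickerPHRho σ m ((Quotient.out w : ↥(flickerPH σ J c)) : ↥(unitaryGroupOfForm σ J)) = z} = F) :
    Nat.card {w : ↥(flickerPH σ J c) ⧸ (flickerHK σ J c um).subgroupOf (flickerPH σ J c) //
      ((Quotient.out w : ↥(flickerPH σ J c)) : ↥(unitaryGroupOfForm σ J))⁻¹ * τ * (Quotient.out w : ↥(flickerPH σ J c)) ∈ flickerHK σ J c um} =
      F * ((q ^ (m - 1) * (q + 1)) * (q ^ ((m - ℓ) - (j - 2 * ℓ)) * (q ^ ((m - ℓ) - 1) * (q + 1)))) := by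
  classical
  -- the restricted involution and the data in `𝒪[K]`
  set σO : 𝒪[K] →+* 𝒪[K] := (σ.comp 𝒪[K].subtype).codRestrict 𝒪[K] hσO with hσOdef
  have hσOσO : ∀ z, σO (σO z) = z := fun z => Subtype.ext (hd.σσ (z : K))
  have hunitO : ∀ {t : K} (ht : Valued.v t = 1), IsUnit (⟨t, ht.le⟩ : 𝒪[K]) := fun ht =>
    (Valuation.Integers.isUnit_iff_valuation_eq_one (Valuation.integer.integers _)).2 ht
  have hϖle : Valued.v ϖ ≤ 1 := by rw [hd.vϖ, ← WithZero.exp_zero]; exact WithZero.exp_le_exp.2 (by norm_num)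
  set pO : 𝒪[K] := ⟨ϖ, hϖle⟩ with hpO
  have hp : Irreducible pO := (IsDiscreteValuationRing.irreducible_iff_uniformizer pO).2 (maximalIdeal_integer_eq_span hd.vϖ)
  have hσp : σO pO = pO := Subtype.ext (by show σ ϖ = ϖ; exact hd.σϖ)
  set eO : 𝒪[K] := ⟨e, he.le⟩ with heO
  have heOu : IsUnit eO := hunitO he
  have hσeO : σO eO = eO := Subtype.ext (by show σ e = e; exact hσe)
  set c₂O : 𝒪[K] := ⟨c₂, hc₂⟩ with hc₂O
  have hσc₂O : σO c₂O = c₂O := Subtype.ext (by show σ c₂ = c₂; exact hσc₂)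
  set gO : 𝒪[K] := ⟨g, hg⟩ with hgO
  have hgOu : IsUnit (σO gO - gO) := (Valuation.Integers.isUnit_iff_valuation_eq_one (Valuation.integer.integers _)).2 hσg
  have hd₁0 : d₁ ≠ 0 := fun h => by rw [h, map_zero] at hd₁; exact zero_ne_one hd₁
  have hd₁i : Valued.v d₁⁻¹ = 1 := by rw [map_inv₀, hd₁, inv_one]
  set d₁O : 𝒪[K] := ⟨d₁, hd₁.le⟩ with hd₁O
  set d₁iO : 𝒪[K] := ⟨d₁⁻¹, hd₁i.le⟩ with hd₁iO
  have hdd : d₁O * d₁iO = 1 := Subtype.ext (by show d₁ * d₁⁻¹ = 1; exact mul_inv_cancel₀ hd₁0)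
  have hσd₁O : σO d₁O = -d₁O := Subtype.ext (by show σ d₁ = -d₁; exact hσd₁)
  set γO : 𝒪[K] := ⟨γ, hγ.le⟩ with hγO
  have hγOu : IsUnit γO := hunitO hγ
  have hσγO : σO γO = γO := Subtype.ext (by show σ γ = γ; exact hσγ)
  have hcv : Valued.v (ϖ ^ (2 * ℓ) * γ) ≤ 1 := by
    rw [map_mul, map_pow, hγ, mul_one]; exact pow_le_one₀ zero_le hϖle
  have hcO : (⟨ϖ ^ (2 * ℓ) * γ, hcv⟩ : 𝒪[K]) = pO ^ (2 * ℓ) * γO := Subtype.ext (by simp [hpO, hγO])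
  -- the reduction maps and the reindexing classes
  set A := 𝒪[K] ⧸ 𝓂[K] ^ m with hA
  set σm := Ideal.quotientMap (maximalIdeal 𝒪[K] ^ m) σO (maximalIdeal_pow_le_comap σO hσOσO m) with hσm
  have hσbar : σm = Ideal.quotientMap (𝓂[K] ^ m) ((σ.comp 𝒪[K].subtype).codRestrict 𝒪[K] hσO) (maximalIdeal_pow_le_comap_codRestrict σ hd.vϖ hd.vσ hσO m) := rfl
  have hσmmk : ∀ t : 𝒪[K], σm (Ideal.Quotient.mk _ t) = Ideal.Quotient.mk _ (σO t) := fun t => Ideal.quotientMap_mk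
  set δ : A := Ideal.Quotient.mk _ d₁O with hδ
  set δi : A := Ideal.Quotient.mk _ d₁iO with hδi
  set κ₂ : A := Ideal.Quotient.mk _ c₂O with hκ₂
  have hδδi : δ * δi = 1 := by rw [hδ, hδi, ← map_mul, hdd, map_one]
  have hδiδ : δi * δ = 1 := by rw [mul_comm, hδδi]
  have hσδ : σm δ = -δ := by rw [hδ, hσmmk, hσd₁O, map_neg]
  have hσδi : σm δi = -δi := by
    have h1 : σm δi * σm δ = 1 := by rw [← map_mul, hδiδ, map_one]
    rw [hσδ, mul_neg] at h1
    calc σm δi = σm δi * (δ * δi) := by rw [hδδi, mul_one]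
      _ = -(-(σm δi * δ)) * δi := by ring
      _ = -δi := by rw [h1]; ring
  have hσκ₂ : σm κ₂ = κ₂ := by rw [hκ₂, hσmmk, hσc₂O]
  -- the predicate counted, and the map `f = ρ_m ∘ out`
  set P := flickerPH σ J c with hPdef
  set S := (flickerHK σ J c um).subgroupOf (flickerPH σ J c) with hSdef
  set f : ↥P ⧸ S → A × A := fun w => flickerPHRho σ m ((Quotient.out w : ↥P) : ↥(unitaryGroupOfForm σ J)) with hfdef
  set Pr : A × A → Prop := fun uy =>
    Ideal.Quotient.factor (Ideal.pow_le_pow_right hjm)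
        ((Ring.inverse (uy.1 * σm uy.1) + Ideal.Quotient.mk (maximalIdeal 𝒪[K] ^ m) eO + uy.2 * Ideal.Quotient.mk (maximalIdeal 𝒪[K] ^ m) gO) *
          σm (Ring.inverse (uy.1 * σm uy.1) + Ideal.Quotient.mk (maximalIdeal 𝒪[K] ^ m) eO + uy.2 * Ideal.Quotient.mk (maximalIdeal 𝒪[K] ^ m) gO)) =
      Ideal.Quotient.mk (maximalIdeal 𝒪[K] ^ j) (pO ^ (2 * ℓ) * γO) with hPrdef
  set Q : A × A → Prop := fun ux => IsUnit ux.1 ∧ σm ux.2 = -ux.2 ∧ Pr (ux.1, ux.2 * δi + κ₂) with hQdef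
  -- Step A: «good» ⟺ `Q ∘ f`
  have stepA : ∀ w : ↥P ⧸ S, ((Quotient.out w : ↥P) : ↥(unitaryGroupOfForm σ J))⁻¹ * τ * (Quotient.out w : ↥P) ∈ flickerHK σ J c um ↔ Q (f w) := by
    intro w
    set pp : ↥(unitaryGroupOfForm σ J) := ((Quotient.out w : ↥P) : ↥(unitaryGroupOfForm σ J)) with hpp
    have hpP : pp ∈ flickerPH σ J c := (Quotient.out w).2
    obtain ⟨u, x, wc, hpm, hvu, hvx, hσx, hvw, hσw⟩ := exists_coe_eq_borel_of_mem_flickerPH' σ hJ hd.σσ hd.vσ h2 hc hpP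
    have hu0 : u ≠ 0 := fun h => by rw [h, map_zero] at hvu; exact zero_ne_one hvu
    have hw0 : wc ≠ 0 := fun h => by rw [h, map_zero] at hvw; exact zero_ne_one hvw
    have hva : Valued.v (u * wc⁻¹) = 1 := by rw [map_mul, map_inv₀, hvu, hvw, inv_one, one_mul]
    have hρ : f w = (Ideal.Quotient.mk (𝓂[K] ^ m) ⟨u * wc⁻¹, hva.le⟩, Ideal.Quotient.mk (𝓂[K] ^ m) ⟨x, hvx⟩) := by
      show flickerPHRho σ m pp = _
      rw [flickerPHRho_of_coe_eq σ m hpm hu0, toQuotPow_of_le m hva.le, toQuotPow_of_le m hvx]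
    have hQ1 : σm (f w).2 = -(f w).2 := by
      rw [hσbar]; exact quotientMap_flickerPHRho_snd_of_unram σ hJ hd h2 hσO hc m hpP
    have hQ2 : IsUnit (f w).1 := isUnit_flickerPHRho_fst_of_unram σ hJ hd h2 hc m hpP
    rw [hce pp hpP u x wc hpm]
    -- rewrite `uσu = N(u w⁻¹)` and pass to classes
    have hσwc : σ wc = wc⁻¹ := eq_inv_of_mul_eq_one_left hσw
    have hN : u * σ u = (u * wc⁻¹) * σ (u * wc⁻¹) := by
      rw [map_mul, map_inv₀, hσwc, inv_inv]; field_simp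
    have hvy : Valued.v (x * d₁⁻¹ + c₂) ≤ 1 := by
      refine le_trans (Valuation.map_add _ _ _) (max_le ?_ hc₂)
      rw [map_mul, hd₁i, mul_one]; exact hvx
    rw [hN, v_norm_sub_le_iff_factor_eq_frame σ hd hσO hjm hva he.le hvy hg hcv, hcO]
    have hy : Ideal.Quotient.mk (𝓂[K] ^ m) (⟨x * d₁⁻¹ + c₂, hvy⟩ : 𝒪[K]) = Ideal.Quotient.mk (𝓂[K] ^ m) ⟨x, hvx⟩ * δi + κ₂ := by
      rw [hδi, hκ₂, ← map_mul, ← map_add]; rfl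
    rw [hρ] at hQ1 hQ2
    rw [hQdef, hρ]
    simp only
    rw [← hy, ← hσbar]
    exact ⟨fun h => ⟨hQ2, hQ1, h⟩, fun h => h.2.2⟩
  -- Step B: count through `f`
  rw [Nat.card_congr (Equiv.subtypeEquivRight stepA), natCard_subtype_comp_eq_mul f Q F hfib]
  congr 1
  -- Step C: the range condition is implied by `Q` (★ C2-A surjectivity + (H1) + `S ≤ N₀`)
  have stepC : ∀ z, Q z → z ∈ Set.range f := by
    rintro ⟨α, β⟩ ⟨hα, hβ, -⟩
    obtain ⟨a, rfl⟩ := Ideal.Quotient.mk_surjective α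
    obtain ⟨bb, rfl⟩ := Ideal.Quotient.mk_surjective β
    have hau : IsUnit a := isUnit_of_isUnit_mk_pow (R := 𝒪[K]) hm hα
    have hav : Valued.v (a : K) = 1 := (Valuation.Integers.isUnit_iff_valuation_eq_one (Valuation.integer.integers _)).1 hau
    rw [hσbar] at hβ
    obtain ⟨pp, hpp, hρ⟩ := exists_mem_flickerPH_flickerPHRho_eq_of_unram σ hJ hd h2 hσO hc m a bb hav hβ
    refine ⟨QuotientGroup.mk ⟨pp, hpp⟩, ?_⟩
    obtain ⟨s, hs'⟩ := QuotientGroup.mk_out_eq_mul S (⟨pp, hpp⟩ : ↥P)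
    show flickerPHRho σ m ((Quotient.out (QuotientGroup.mk (⟨pp, hpp⟩ : ↥P) : ↥P ⧸ S) : ↥P) : ↥(unitaryGroupOfForm σ J)) = _
    rw [hs', Subgroup.coe_mul, ← hρ]
    symm
    rw [flickerPHRho_eq_iff_of_unram σ hJ hd h2 hc m hpp (Subgroup.mul_mem _ hpp (s : ↥P).2), ← mul_assoc, inv_mul_cancel, one_mul]
    exact hSN ⟨(s : ↥P).2, s.2⟩
  rw [Nat.card_congr (Equiv.subtypeEquivRight fun z => (and_iff_right_of_imp (stepC z) : z ∈ Set.range f ∧ Q z ↔ Q z))]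
  -- Step D: reindex anti-fixed `x̄` ↔ fixed `ȳ = x̄·δ⁻¹ + κ₂`, then the frame-currency pair count at `R = 𝒪[K]`
  have eD : {ux : A × A // Q ux} ≃ {uy : A × A // IsUnit uy.1 ∧ σm uy.2 = uy.2 ∧ Pr uy} :=
    { toFun := fun w => ⟨(w.1.1, w.1.2 * δi + κ₂), w.2.1, by
          show σm (w.1.2 * δi + κ₂) = w.1.2 * δi + κ₂
          rw [map_add, map_mul, w.2.2.1, hσδi, hσκ₂]; ring, w.2.2.2⟩
      invFun := fun w => ⟨(w.1.1, (w.1.2 - κ₂) * δ), w.2.1, by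
          show σm ((w.1.2 - κ₂) * δ) = -((w.1.2 - κ₂) * δ)
          rw [map_mul, map_sub, w.2.2.1, hσκ₂, hσδ]; ring, by
          show Pr (w.1.1, (w.1.2 - κ₂) * δ * δi + κ₂)
          rw [mul_assoc, hδδi, mul_one, sub_add_cancel]; exact w.2.2.2⟩
      left_inv := fun w => by
        apply Subtype.ext
        show (w.1.1, (w.1.2 * δi + κ₂ - κ₂) * δ) = w.1
        rw [add_sub_cancel_right, mul_assoc, hδiδ, mul_one]
      right_inv := fun w => by
        apply Subtype.ext
        show (w.1.1, (w.1.2 - κ₂) * δ * δi + κ₂) = w.1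
        rw [mul_assoc, hδδi, mul_one, sub_add_cancel] }
  rw [Nat.card_congr eD]
  exact natCard_pairs_norm_congr_shift_frame_of_isUnit σO hσOσO ha₀ hq hgOu hp hσp hm hℓ hj hjm heOu hσeO hγOu hσγO

end Count

end UnitaryGroup

end Literature.NumberTheory.Automorphic
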